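import Mathlib
import Summits.Ventures.FusionMHD.Models.SolovevPCFMercierAxis
import Literature.MathematicalPhysics.MHD.SolovevFluxSurfaceLoop
import Summits.Ventures.FusionMHD.Bench.SolovevPCFIterQedgeClosedForm
import Summits.Ventures.FusionMHD.Bench.SolovevPCFNstxQedgeClosedForm
import HarnessLib

/-!
# Ventures/FusionMHD — Models/SolovevPCFSafetyFactorProfile.lean: the exact safety-factor PROFILE of the F1.a
# analytic equilibria of record, as Freidberg's functional (6.35) on the printed flux-surface loops

HONEST FRAMING (LADDER-GRIDFUSION three columns). The equilibria are the ANALYTIC PCF Solov'ev instances of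
`Models/SolovevPCF.lean` (MODELLED: ideal MHD, axisymmetric, Solov'ev profiles `μ₀p′ = −1`, `FF′ = 0`, fixed
boundary; «ITER-like»/«NSTX-like» name printed shape triples only); the free constant `F = R B_φ` stays a
parameter. CERTIFIED content (kernel, this file): exact identities — no enclosure, no stability word.

What is proved, per instance (`IterLike`, `NstxLike`):
* `psi_eq_psiLC` — the instance IS a Lee–Cerfon/CHEASE Solov'ev equilibrium (Lee–Cerfon 2015 §4.1 (solo2),
  `Solovev.psiLC`) with EXPLICIT parameters: axis radius `R_a`, on-axis elongation `κ₀ = (Ψ_RR/Ψ_ZZ)^{1/2}`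
  (Freidberg (6.42)), on-axis safety factor `q₀(F)` (Freidberg (6.42), `= F·√r`), effective minor radius
  `a = ε/R_a` (so `R_a² ± 2aR_a = (1 ± ε)²`) — for every `F ≠ 0` (`lcAmplitude`: `κ₀F/(2R_a³q₀) = 1/2 + 4d₃`);
* **`safetyFactorE_surface`** — for every `F > 0` and EVERY flux surface `0 < r < R_a/2`, Freidberg's safety factor
  (6.35) with Euclidean arc length (`GradShafranov.safetyFactorE`, RULING-15 repair) on the PRINTED loop
  `R² = R_a² + 2rR_a cos t`, `Z = κ₀ r (R_a/R) sin t` (`Solovev.lcLoop`) equals the PRINTED closed form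
  `qLC (q₀ F) R_a R_min R_max = (2q₀/π)(R_a³/(R_min²R_max)) E(k)`, `R_min,max = (R_a² ∓ 2rR_a)^{1/2}` — by the
  generic theorem `Solovev.safetyFactorE_lcLoop_eq_qLC` (`Literature/…/SolovevFluxSurfaceLoop.lean`);
* `safetyFactorE_edge` — at the plasma edge `r = ε/R_a`: `= qLC (q₀ F) R_a (1−ε) (1+ε)`;
* **`safetyFactorE_edge_eq_qEdgeOverF`** — `= F · qEdgeOverF`, sos-6's CERTIFIED edge number
  (`Bench/SolovevPCF{Iter,Nstx}Qedge.lean`, enclosures there), through lit-4's closed-form identity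
  `qEdgeOverF_eq_qLC` (`Bench/SolovevPCF{Iter,Nstx}QedgeClosedForm.lean`). This is an INDEPENDENT second loop
  for the same statement sos-6 proved on its four-arc algebraic loop (`Bench/SolovevPCF{Iter,Nstx}QedgeLoop.lean`):
  two different parametrisations of `{Ψ = 0}` give the same value of the Literature functional, as they must.

Use (F1/F2): the q-PROFILE of the instance of record is now an exact closed form on every surface (truth data for
the F2 q-line, pub/gridfusion/bench/F2-INSTANCE.md v1.2-f); shear statements (`q` vs `r`) reduce to properties of
`E(k)/(R_min²R_max)`. Typer/prover: gridfusion-model-5 (g2), 2026-08-26. Citations: Freidberg 2014 (6.35)/(6.42)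
[Freidberg2014]; Lee–Cerfon 2015 §4.1 (solo2)/(q4) [LeeCerfon2015]; Pataki–Cerfon–Freidberg 2013 §6.1
[PatakiCerfonFreidberg2013].
-/

noncomputable section

namespace Summit.Ventures.FusionMHD.Models.SolovevPCF

open Literature.MathematicalPhysics.MHD Literature.MathematicalPhysics.MHD.GradShafranov
  Literature.MathematicalPhysics.MHD.Solovev _root_.Real

namespace IterLike

/-- The on-axis elongation `κ₀ = (Ψ_RR/Ψ_ZZ)^{1/2}` of the instance (Freidberg (6.42); `= √(2257675225/758468676)`),
named so that rewriting `psi` does not touch it. -/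
def kappa0 : ℝ := elongationOnAxis (dRR psi Ra 0) (dZZ psi Ra 0)

/-- The on-axis safety factor `q₀(F)` of the instance for the free constant `F = R B_φ` (Freidberg (6.42)). -/
def q0 (F : ℝ) : ℝ := safetyFactorOnAxis F Ra (dRR psi Ra 0) (dZZ psi Ra 0)

/-- `κ₀ > 0`. -/
theorem kappa0_pos : 0 < kappa0 := elongationOnAxis_pos

/-- `κ₀² = E = 2257675225/758468676`. -/
theorem kappa0_sq : kappa0 ^ 2 = elongSq := elongationOnAxis_sq

/-- `q₀(F) = F·√r` with `r = q₀²/F²` the exact rational of `Models/SolovevPCF` (`F ≥ 0`). -/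
theorem q0_eq (F : ℝ) (hF : 0 ≤ F) : q0 F = F * Real.sqrt q0SqOverFSq := by
  have hq : 0 ≤ q0 F := by
    obtain ⟨h1, h2⟩ := hessian_axis
    unfold q0 safetyFactorOnAxis
    rw [h1, h2]
    exact div_nonneg hF (mul_nonneg Ra_pos.le (Real.sqrt_nonneg _))
  rw [← Real.sqrt_sq hq, show q0 F ^ 2 = F ^ 2 * q0SqOverFSq from q0_sq F, Real.sqrt_mul (sq_nonneg F),
    Real.sqrt_sq hF]

/-- `q₀(F) > 0` for `F > 0`. -/
theorem q0_pos {F : ℝ} (hF : 0 < F) : 0 < q0 F := by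
  rw [q0_eq F hF.le]
  exact mul_pos hF (Real.sqrt_pos.2 (by unfold q0SqOverFSq; norm_num))

/-- The Lee–Cerfon amplitude of the instance: `κ₀F/(2R_a³q₀(F)) = 1/2 + 4d₃` (`F ≠ 0`; `κ₀√(Ψ_RRΨ_ZZ) = Ψ_RR`). -/
theorem lcAmplitude {F : ℝ} (hF : F ≠ 0) : kappa0 * F / (2 * Ra ^ 3 * q0 F) = 1 / 2 + 4 * d₃ := by
  obtain ⟨h1, h2⟩ := hessian_axis
  have hk : kappa0 = Real.sqrt elongSq := elongationOnAxis_eq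
  unfold q0 safetyFactorOnAxis
  rw [hk, h1, h2]
  unfold elongSq d₃
  have hRa3 : Ra ^ 3 = Ra * (689 / 625) := by rw [← Ra_sq]; ring
  rw [hRa3]
  set K := Real.sqrt (2257675225 / 758468676 : ℝ) with hK
  set S := Real.sqrt ((62221529201 / 75403597525 : ℝ) * (522584917764 / 1885089938125)) with hS
  have hs : K * S = 62221529201 / 75403597525 := by
    rw [hK, hS, ← Real.sqrt_mul (by norm_num), show (2257675225 / 758468676 : ℝ)
      * ((62221529201 / 75403597525 : ℝ) * (522584917764 / 1885089938125))
      = (62221529201 / 75403597525) ^ 2 by norm_num, Real.sqrt_sq (by norm_num)]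
  have hRa : Ra ≠ 0 := Ra_pos.ne'
  have hSne : S ≠ 0 := by rw [hS]; exact (Real.sqrt_pos.2 (by norm_num)).ne'
  have e : K * F / (2 * (Ra * (689 / 625)) * (F / (Ra * S))) = K * S * (625 / 1378) := by
    field_simp
    ring
  rw [e, hs]
  norm_num

/-- **The instance IS a Lee–Cerfon/CHEASE equilibrium with explicit parameters:** for every `F ≠ 0`,
`Ψ = psiLC κ₀ F R_a (q₀ F) (ε/R_a)` (axis radius `R_a`, on-axis elongation `κ₀`, on-axis safety factor `q₀(F)`,
effective minor radius `a = ε/R_a`, so `R_a² ± 2aR_a = (1 ± ε)²`). -/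
theorem psi_eq_psiLC {F : ℝ} (hF : F ≠ 0) : psi = psiLC kappa0 F Ra (q0 F) (ε / Ra) := by
  funext R Z
  have hc := lcAmplitude hF
  have hu : (1 / 2 + 4 * d₃) * (689 / 625) = -(2 * d₂) := by unfold d₃ d₂; norm_num
  have hRa : Ra ≠ 0 := Ra_pos.ne'
  unfold psiLC
  rw [hc, show psi = psiPCF d₁ d₂ d₃ from rfl, psiPCF_eq_LCform hu R Z, kappa0_sq, Ra_sq,
    show (ε / Ra) ^ 2 * (689 / 625 : ℝ) = ε ^ 2 by rw [← Ra_sq]; field_simp]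
  unfold elongSq d₁ d₃ ε
  ring

/-- **The exact q-PROFILE of the ITER-like instance as Freidberg's functional (6.35):** for every `F > 0` and every
flux surface of effective minor radius `0 < r < R_a/2` (printed Lee–Cerfon loop `R² = R_a² + 2rR_a cos t`,
`Z = κ₀ r (R_a/R) sin t`), `safetyFactorE F Ψ γ_r (2π) = (2q₀(F)/π)(R_a³/(R_min²R_max)) E(k)`,
`R_min,max = (R_a² ∓ 2rR_a)^{1/2}`. -/
theorem safetyFactorE_surface {F r : ℝ} (hF : 0 < F) (hr : 0 < r) (h2r : 2 * r < Ra) :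
    safetyFactorE F psi (lcLoop Ra kappa0 r) (2 * π)
      = qLC (q0 F) Ra (Real.sqrt (Ra ^ 2 - 2 * r * Ra)) (Real.sqrt (Ra ^ 2 + 2 * r * Ra)) := by
  rw [psi_eq_psiLC hF.ne']
  exact safetyFactorE_lcLoop_eq_qLC Ra_pos kappa0_pos hF (q0_pos hF) hr h2r (ε / Ra)

/-- The plasma edge `Ψ = 0` is the surface `r = a = ε/R_a`, and `0 < 2a < R_a`. -/
theorem edge_minorRadius : 0 < ε / Ra ∧ 2 * (ε / Ra) < Ra := by
  have hRa := Ra_pos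
  refine ⟨by unfold ε; positivity, ?_⟩
  rw [show 2 * (ε / Ra) = 2 * ε / Ra by ring, div_lt_iff₀ hRa, ← sq, Ra_sq]
  unfold ε; norm_num

/-- **At the edge** (`r = ε/R_a`, `R_min = 1 − ε = 17/25`, `R_max = 1 + ε = 33/25`):
`safetyFactorE F Ψ γ_edge (2π) = qLC (q₀ F) R_a (17/25) (33/25)`. -/
theorem safetyFactorE_edge {F : ℝ} (hF : 0 < F) :
    safetyFactorE F psi (lcLoop Ra kappa0 (ε / Ra)) (2 * π) = qLC (q0 F) Ra (17 / 25) (33 / 25) := by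
  obtain ⟨ha, h2a⟩ := edge_minorRadius
  rw [safetyFactorE_surface hF ha h2a]
  have hRa : Ra ≠ 0 := Ra_pos.ne'
  have e1 : Ra ^ 2 - 2 * (ε / Ra) * Ra = (17 / 25) ^ 2 := by
    rw [Ra_sq, show 2 * (ε / Ra) * Ra = 2 * ε by field_simp]; unfold ε; norm_num
  have e2 : Ra ^ 2 + 2 * (ε / Ra) * Ra = (33 / 25) ^ 2 := by
    rw [Ra_sq, show 2 * (ε / Ra) * Ra = 2 * ε by field_simp]; unfold ε; norm_num
  rw [e1, e2, Real.sqrt_sq (by norm_num), Real.sqrt_sq (by norm_num)]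

/-- **Cross-check with the certified edge number:** on the printed smooth loop, Freidberg's (6.35) at the edge equals
`F · qEdgeOverF` of sos-6's Bench certificate (via lit-4's closed form `qEdgeOverF_eq_qLC`) — the same value sos-6
obtained on its four-arc algebraic loop (`Bench/SolovevPCFIterQedgeLoop.lean`). -/
theorem safetyFactorE_edge_eq_qEdgeOverF {F : ℝ} (hF : 0 < F) :
    safetyFactorE F psi (lcLoop Ra kappa0 (ε / Ra)) (2 * π) = F * Bench.SolovevPCFIter.qEdgeOverF := by
  rw [safetyFactorE_edge hF, Bench.SolovevPCFIter.qEdgeOverF_eq_qLC, q0_eq F hF.le]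
  have hr : (Bench.SolovevPCFIter.q0OverFSq : ℝ) = q0SqOverFSq := by
    unfold Bench.SolovevPCFIter.q0OverFSq q0SqOverFSq; push_cast; norm_num
  rw [hr, show Ra = Real.sqrt (689 / 625) from rfl]
  unfold qLC
  ring

end IterLike

namespace NstxLike

/-- The on-axis elongation `κ₀ = (Ψ_RR/Ψ_ZZ)^{1/2}` of the instance (Freidberg (6.42); `= √(3382585600/833319279)`),
named so that rewriting `psi` does not touch it. -/
def kappa0 : ℝ := elongationOnAxis (dRR psi Ra 0) (dZZ psi Ra 0)

/-- The on-axis safety factor `q₀(F)` of the instance for the free constant `F = R B_φ` (Freidberg (6.42)). -/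
def q0 (F : ℝ) : ℝ := safetyFactorOnAxis F Ra (dRR psi Ra 0) (dZZ psi Ra 0)

/-- `κ₀ > 0`. -/
theorem kappa0_pos : 0 < kappa0 := elongationOnAxis_pos

/-- `κ₀² = E = 3382585600/833319279`. -/
theorem kappa0_sq : kappa0 ^ 2 = elongSq := elongationOnAxis_sq

/-- `q₀(F) = F·√r` with `r = q₀²/F²` the exact rational of `Models/SolovevPCF` (`F ≥ 0`). -/
theorem q0_eq (F : ℝ) (hF : 0 ≤ F) : q0 F = F * Real.sqrt q0SqOverFSq := by
  have hq : 0 ≤ q0 F := by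
    obtain ⟨h1, h2⟩ := hessian_axis
    unfold q0 safetyFactorOnAxis
    rw [h1, h2]
    exact div_nonneg hF (mul_nonneg Ra_pos.le (Real.sqrt_nonneg _))
  rw [← Real.sqrt_sq hq, show q0 F ^ 2 = F ^ 2 * q0SqOverFSq from q0_sq F, Real.sqrt_mul (sq_nonneg F),
    Real.sqrt_sq hF]

/-- `q₀(F) > 0` for `F > 0`. -/
theorem q0_pos {F : ℝ} (hF : 0 < F) : 0 < q0 F := by
  rw [q0_eq F hF.le]
  exact mul_pos hF (Real.sqrt_pos.2 (by unfold q0SqOverFSq; norm_num))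

/-- The Lee–Cerfon amplitude of the instance: `κ₀F/(2R_a³q₀(F)) = 1/2 + 4d₃` (`F ≠ 0`; `κ₀√(Ψ_RRΨ_ZZ) = Ψ_RR`). -/
theorem lcAmplitude {F : ℝ} (hF : F ≠ 0) : kappa0 * F / (2 * Ra ^ 3 * q0 F) = 1 / 2 + 4 * d₃ := by
  obtain ⟨h1, h2⟩ := hessian_axis
  have hk : kappa0 = Real.sqrt elongSq := elongationOnAxis_eq
  unfold q0 safetyFactorOnAxis
  rw [hk, h1, h2]
  unfold elongSq d₃
  have hRa3 : Ra ^ 3 = Ra * (4021 / 2500) := by rw [← Ra_sq]; ring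
  rw [hRa3]
  set K := Real.sqrt (3382585600 / 833319279 : ℝ) with hK
  set S := Real.sqrt ((136013766976 / 105397621975 : ℝ) * (3350776820859 / 10539762197500)) with hS
  have hs : K * S = 136013766976 / 105397621975 := by
    rw [hK, hS, ← Real.sqrt_mul (by norm_num), show (3382585600 / 833319279 : ℝ)
      * ((136013766976 / 105397621975 : ℝ) * (3350776820859 / 10539762197500))
      = (136013766976 / 105397621975) ^ 2 by norm_num, Real.sqrt_sq (by norm_num)]
  have hRa : Ra ≠ 0 := Ra_pos.ne'
  have hSne : S ≠ 0 := by rw [hS]; exact (Real.sqrt_pos.2 (by norm_num)).ne'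
  have e : K * F / (2 * (Ra * (4021 / 2500)) * (F / (Ra * S))) = K * S * (1250 / 4021) := by
    field_simp
    ring
  rw [e, hs]
  norm_num

/-- **The instance IS a Lee–Cerfon/CHEASE equilibrium with explicit parameters:** for every `F ≠ 0`,
`Ψ = psiLC κ₀ F R_a (q₀ F) (ε/R_a)` (axis radius `R_a`, on-axis elongation `κ₀`, on-axis safety factor `q₀(F)`,
effective minor radius `a = ε/R_a`, so `R_a² ± 2aR_a = (1 ± ε)²`). -/
theorem psi_eq_psiLC {F : ℝ} (hF : F ≠ 0) : psi = psiLC kappa0 F Ra (q0 F) (ε / Ra) := by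
  funext R Z
  have hc := lcAmplitude hF
  have hu : (1 / 2 + 4 * d₃) * (4021 / 2500) = -(2 * d₂) := by unfold d₃ d₂; norm_num
  have hRa : Ra ≠ 0 := Ra_pos.ne'
  unfold psiLC
  rw [hc, show psi = psiPCF d₁ d₂ d₃ from rfl, psiPCF_eq_LCform hu R Z, kappa0_sq, Ra_sq,
    show (ε / Ra) ^ 2 * (4021 / 2500 : ℝ) = ε ^ 2 by rw [← Ra_sq]; field_simp]
  unfold elongSq d₁ d₃ ε
  ring

/-- **The exact q-PROFILE of the NSTX-like instance as Freidberg's functional (6.35):** for every `F > 0` and every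
flux surface of effective minor radius `0 < r < R_a/2` (printed Lee–Cerfon loop `R² = R_a² + 2rR_a cos t`,
`Z = κ₀ r (R_a/R) sin t`), `safetyFactorE F Ψ γ_r (2π) = (2q₀(F)/π)(R_a³/(R_min²R_max)) E(k)`,
`R_min,max = (R_a² ∓ 2rR_a)^{1/2}`. -/
theorem safetyFactorE_surface {F r : ℝ} (hF : 0 < F) (hr : 0 < r) (h2r : 2 * r < Ra) :
    safetyFactorE F psi (lcLoop Ra kappa0 r) (2 * π)
      = qLC (q0 F) Ra (Real.sqrt (Ra ^ 2 - 2 * r * Ra)) (Real.sqrt (Ra ^ 2 + 2 * r * Ra)) := by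
  rw [psi_eq_psiLC hF.ne']
  exact safetyFactorE_lcLoop_eq_qLC Ra_pos kappa0_pos hF (q0_pos hF) hr h2r (ε / Ra)

/-- The plasma edge `Ψ = 0` is the surface `r = a = ε/R_a`, and `0 < 2a < R_a`. -/
theorem edge_minorRadius : 0 < ε / Ra ∧ 2 * (ε / Ra) < Ra := by
  have hRa := Ra_pos
  refine ⟨by unfold ε; positivity, ?_⟩
  rw [show 2 * (ε / Ra) = 2 * ε / Ra by ring, div_lt_iff₀ hRa, ← sq, Ra_sq]
  unfold ε; norm_num

/-- **At the edge** (`r = ε/R_a`, `R_min = 1 − ε = 11/50`, `R_max = 1 + ε = 89/50`):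
`safetyFactorE F Ψ γ_edge (2π) = qLC (q₀ F) R_a (17/25) (33/25)`. -/
theorem safetyFactorE_edge {F : ℝ} (hF : 0 < F) :
    safetyFactorE F psi (lcLoop Ra kappa0 (ε / Ra)) (2 * π) = qLC (q0 F) Ra (11 / 50) (89 / 50) := by
  obtain ⟨ha, h2a⟩ := edge_minorRadius
  rw [safetyFactorE_surface hF ha h2a]
  have hRa : Ra ≠ 0 := Ra_pos.ne'
  have e1 : Ra ^ 2 - 2 * (ε / Ra) * Ra = (11 / 50) ^ 2 := by
    rw [Ra_sq, show 2 * (ε / Ra) * Ra = 2 * ε by field_simp]; unfold ε; norm_num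
  have e2 : Ra ^ 2 + 2 * (ε / Ra) * Ra = (89 / 50) ^ 2 := by
    rw [Ra_sq, show 2 * (ε / Ra) * Ra = 2 * ε by field_simp]; unfold ε; norm_num
  rw [e1, e2, Real.sqrt_sq (by norm_num), Real.sqrt_sq (by norm_num)]

/-- **Cross-check with the certified edge number:** on the printed smooth loop, Freidberg's (6.35) at the edge equals
`F · qEdgeOverF` of sos-6's Bench certificate (via lit-4's closed form `qEdgeOverF_eq_qLC`) — the same value sos-6
obtained on its four-arc algebraic loop (`Bench/SolovevPCFNstxQedgeLoop.lean`). -/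
theorem safetyFactorE_edge_eq_qEdgeOverF {F : ℝ} (hF : 0 < F) :
    safetyFactorE F psi (lcLoop Ra kappa0 (ε / Ra)) (2 * π) = F * Bench.SolovevPCFNstx.qEdgeOverF := by
  rw [safetyFactorE_edge hF, Bench.SolovevPCFNstx.qEdgeOverF_eq_qLC, q0_eq F hF.le]
  have hr : (Bench.SolovevPCFNstx.q0OverFSq : ℝ) = q0SqOverFSq := by
    unfold Bench.SolovevPCFNstx.q0OverFSq q0SqOverFSq; push_cast; norm_num
  rw [hr, show Ra = Real.sqrt (4021 / 2500) from rfl]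
  unfold qLC
  ring

end NstxLike

end Summit.Ventures.FusionMHD.Models.SolovevPCF
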